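/-
Summits.Schanuel.HardCores — GENERATED by harness/kit/hardcore_registry.py (2026-08-18T11:48:14Z) from harness/kit/hardcore_seeds.json (FILTER-SYNTHESIS 2026-08-18 F1).
Tags existing OPEN statement items as famous open sub-summit problems (`@[hard_core]`); the kernel tribunal (t1h) flags routes whose crux meets one
(frontier shelf, never a fail; the owner route is exempt). 4 item(s) tagged; 0 unresolved: []
NEVER import this from a Theorems/Theses/Cruxes file.
-/
import Summits.Schanuel.Schanuel.Theses.ExceptionalSubspaces
import Summits.Schanuel.Schanuel.Theses.LogPatterns
import Summits.Schanuel.Schanuel.Theses.CyclotomicRigidity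
import Summits.Schanuel.Schanuel.Theses.TateNomes
import HarnessLib.Audit.TribunalTags

-- stmt-Schanuel-9548 · RelSchanuelOverPiLWField · four exponentials / algebraic independence of logarithms / relative Schanuel
attribute [hard_core "Schanuel" "four exponentials / algebraic independence of logarithms / relative Schanuel"] Summit.Schanuel.Schanuel.Theses.ExceptionalSubspaces.RelSchanuelOverPiLWField
-- stmt-Schanuel-4310 · LogSector · four exponentials / algebraic independence of logarithms / relative Schanuel
attribute [hard_core "Schanuel" "four exponentials / algebraic independence of logarithms / relative Schanuel"] Summit.Schanuel.Schanuel.Theses.LogPatterns.LogSector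
-- stmt-Schanuel-5989 · TowerStrong · four exponentials / algebraic independence of logarithms / relative Schanuel
attribute [hard_core "Schanuel" "four exponentials / algebraic independence of logarithms / relative Schanuel"] Summit.Schanuel.Schanuel.Theses.CyclotomicRigidity.TowerStrong
-- stmt-Schanuel-17404 · TateLocusGPC · four exponentials / algebraic independence of logarithms / relative Schanuel
attribute [hard_core "Schanuel" "four exponentials / algebraic independence of logarithms / relative Schanuel"] Summit.Schanuel.Schanuel.Theses.TateNomes.TateLocusGPC
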